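import Summits.HubbardSuperconductivity.HubbardSuperconductivity.Theorems.DeformationLadderLadderThesisNormalForms

/-!
# Route `TwistGap`, support `TgCruxGlue` (item `stmt-HubbardSuperconductivity-1511`)

`TgCruxGlue : TgPairMomentumRigidity → TgLowEnergyCondensation → TgThesis`.

Notation (even `L`, sector `K_L = szSector N_L 0`, `N_L = 2⌊(1−δ)L²/2⌋`, `H_L = hubbardTorus 2 L 1 U`,
`E₀ = minEnergyOn H_L K_L`): for a pair momentum `k ∈ (ℤ/Lℤ)²` put
`Δ_d(k) := Σ_x e^{−2πi k·x/L} localPair_d x` and `P_k(φ) := L⁻⁴ Re⟨φ, Δ_d(k)ᴴΔ_d(k) φ⟩`; the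
infrared window is `W_K = {k : min(k_i, L − k_i) ≤ K, i = 1,2}`.

* `TgLowEnergyCondensation` supplies a witness `(U, δ, K, θ, Γ)`: every unit `φ ∈ K_L` with
  `⟨H_L⟩_φ ≤ E₀ + Γ` has `Σ_{k ∈ W_K} P_k(φ) ≥ θ`.
* `TgPairMomentumRigidity` at `(U, δ, K, σ := θ/2)` supplies `γ > 0` with
  `γ (Σ_{0 ≠ k ∈ W_K} P_k(φ) − θ/2) ≤ ⟨H_L⟩_φ − E₀` for every unit `φ ∈ K_L`.

Hence every unit `φ ∈ K_L` with `⟨H_L⟩_φ − E₀ ≤ κ := min(Γ, γθ/4)` has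
`Σ_{0 ≠ k ∈ W_K} P_k(φ) ≤ 3θ/4` and so `P_0(φ) ≥ θ/4`; and `P_0(φ) = L⁻⁴ Re⟨φ, Δ_dᴴΔ_d φ⟩` because
`Δ_d(0) = Σ_x localPair_d x = pairField dWaveFormFactor L` (`pairMode_zero`). That is exactly
route DeformationLadder's `LowEnergyRigidity` with `(κ, a) = (min(Γ, γθ/4), θ/4)`
(`lowEnergyRigidity_of_tgCruxes`), and `LowEnergyRigidity ↔ TgThesis` is the tree's
`lowEnergyRigidity_iff_tgThesis` (`Theorems/DeformationLadderLadderThesisNormalForms.lean`; its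
`→` direction is the spectral bookkeeping "low-energy LRO floor ⇒ `S⁺`" of the item text, done once
and for all through the penalised ground states). Finite sums and linear arithmetic only.

Sources: the glue arithmetic is the item's own (planner card `TwistGap`, refuter review 77f872db);
H. Tasaki, *Physics and Mathematics of Quantum Many-Body Systems* (2020) §2.1 for the variational
principle behind `lowEnergyRigidity_iff_tgThesis`. No definition is introduced.
-/

set_option linter.dupNamespace false

noncomputable section

namespace Summit.HubbardSuperconductivity.HubbardSuperconductivity.Theorems.TwistGap

open Matrix Literature.MathematicalPhysics.QuantumLattice Literature.Probability.LatticeModels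
open Summit.HubbardSuperconductivity.HubbardSuperconductivity.Theses.TwistGap
open Summit.HubbardSuperconductivity.HubbardSuperconductivity.Theses.DeformationLadder (LowEnergyRigidity)
open Summit.HubbardSuperconductivity.HubbardSuperconductivity.Theorems.DeformationLadder
  (lowEnergyRigidity_iff_tgThesis)

/-- The zero pair momentum lies in every infrared window `W_K`. [folklore] -/
theorem zero_mem_window (L : ℕ) [NeZero L] (K : ℕ) :
    (0 : TorusSite 2 L) ∈ Finset.univ.filter
      (fun k : TorusSite 2 L => ∀ i : Fin 2, min (k i).val (L - (k i).val) ≤ K) := by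
  simp

/-- Splitting the window sum at `k = 0`: `Σ_{k ∈ W_K} f k = f 0 + Σ_{0 ≠ k ∈ W_K} f k`. [folklore] -/
theorem windowSum_eq_zero_add (L : ℕ) [NeZero L] (K : ℕ) (f : TorusSite 2 L → ℝ) :
    ∑ k ∈ Finset.univ.filter
        (fun k : TorusSite 2 L => ∀ i : Fin 2, min (k i).val (L - (k i).val) ≤ K), f k =
      f 0 + ∑ k ∈ Finset.univ.filter
        (fun k : TorusSite 2 L => k ≠ 0 ∧ ∀ i : Fin 2, min (k i).val (L - (k i).val) ≤ K), f k := by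
  rw [← Finset.add_sum_erase _ f (zero_mem_window L K)]
  congr 1
  refine Finset.sum_congr ?_ fun _ _ => rfl
  ext k
  simp only [Finset.mem_erase, Finset.mem_filter, Finset.mem_univ, true_and, ne_eq]

/-- The zero-momentum pair mode is the pair field: `Δ_d(0) = Σ_x localPair_d x = pairField d L`
(all phases `e^{−2πi 0·x/L} = 1`). Scalapino, Phys. Rep. 250 (1995) 329, §2, eq. (2.2). [folklore] -/
theorem pairMode_zero (L : ℕ) [NeZero L] :
    (∑ x : TorusSite 2 L, Complex.exp (-(2 * (Real.pi : ℂ) * Complex.I / (L : ℂ)) *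
        ((∑ i : Fin 2, ((0 : TorusSite 2 L) i).val * (x i).val : ℕ) : ℂ)) •
          localPair dWaveFormFactor L x) =
      pairField dWaveFormFactor L := by
  simp [pairField]

/-- **The two TwistGap cruxes give low-energy rigidity.** From `TgPairMomentumRigidity` (pair
weight at nonzero infrared pair momenta costs total energy at rate `γ`, slack `σ = θ/2`) and
`TgLowEnergyCondensation` (witness `(U, δ, K, θ, Γ)`: every state within `Γ` of `E₀` carries window
weight `≥ θ`): every unit sector vector with `⟨H_L⟩_φ ≤ E₀ + min(Γ, γθ/4)` has
`Σ_{0≠k∈W_K} P_k ≤ 3θ/4`, hence `P_0 = L⁻⁴Re⟨φ, Δ_dᴴΔ_d φ⟩ ≥ θ/4` — route DeformationLadder's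
`LowEnergyRigidity` with `(κ, a) = (min(Γ, γθ/4), θ/4)`. [folklore] -/
theorem lowEnergyRigidity_of_tgCruxes (hR : TgPairMomentumRigidity) (hC : TgLowEnergyCondensation) :
    LowEnergyRigidity := by
  obtain ⟨U, hU, δ, hδ, K, θ, hθ, Γ, hΓ, L₀, hC⟩ := hC
  obtain ⟨γ, hγ, L₁, hR⟩ := hR U hU δ hδ K (θ / 2) (by positivity)
  refine ⟨U, hU, δ, hδ, min Γ (γ * (θ / 4)), lt_min hΓ (by positivity), θ / 4, by positivity,
    max L₀ L₁, fun L _ hL hev φ hmem hφ1 hE => ?_⟩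
  -- the two energy windows
  have hmin₁ : min Γ (γ * (θ / 4)) ≤ Γ := min_le_left _ _
  have hmin₂ : min Γ (γ * (θ / 4)) ≤ γ * (θ / 4) := min_le_right _ _
  have hEΓ : (expect (hubbardTorus 2 L 1 U) φ).re ≤
      (hubbardTorus 2 L 1 U).minEnergyOn (szSector (2 * ⌊(1 - δ) * (L : ℝ) ^ 2 / 2⌋₊) 0) + Γ := by
    unfold expect
    linarith
  have hEγ : (expect (hubbardTorus 2 L 1 U) φ).re -
      (hubbardTorus 2 L 1 U).minEnergyOn (szSector (2 * ⌊(1 - δ) * (L : ℝ) ^ 2 / 2⌋₊) 0) ≤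
      γ * (θ / 4) := by
    unfold expect
    linarith
  -- condensation: window weight ≥ θ
  have h1 := hC L (le_of_max_le_left hL) hev φ hmem hφ1 hEΓ
  -- rigidity: off-zero window weight ≤ θ/2 + (⟨H⟩ − E₀)/γ ≤ 3θ/4
  have h2 := hR L (le_of_max_le_right hL) hev φ hmem hφ1
  have h3 := le_of_mul_le_mul_left (h2.trans hEγ) hγ
  -- split the window sum at k = 0 and identify the k = 0 mode with the pair field
  rw [windowSum_eq_zero_add] at h1
  simp only [pairMode_zero] at h1
  linarith

/-- **`TgCruxGlue` holds** (route `TwistGap`, support item `stmt-HubbardSuperconductivity-1511`):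
`TgPairMomentumRigidity → TgLowEnergyCondensation → TgThesis`, through low-energy rigidity
(`lowEnergyRigidity_of_tgCruxes`) and the tree's `lowEnergyRigidity_iff_tgThesis` (the spectral /
variational step "low-energy LRO floor ⇒ `S⁺`"). Tasaki (2020) §2.1. [folklore] -/
theorem tgCruxGlue_proof : TgCruxGlue := fun hR hC =>
  lowEnergyRigidity_iff_tgThesis.mp (lowEnergyRigidity_of_tgCruxes hR hC)

end Summit.HubbardSuperconductivity.HubbardSuperconductivity.Theorems.TwistGap
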